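import Literature.AlgebraicGeometry.Frobenioids.ModelFrobenioidMap
import HarnessLib

/-!
# Frobenioids I, Prop. 5.3: the row `(C^un-tr)^pf → C^rlf` of the realification diagram, in the model
# description, and its 1-commutativity with `C^un-tr → (C^un-tr)^pf` and `C^un-tr → C^rlf`

Mochizuki, *The geometry of Frobenioids I: the general theory*, Kyushu J. Math. **62** (2008) 293–400,
§5, Proposition 5.3 p. 103 [cite: MochizukiFrdI2008, Prop. 5.3 p.103]: "there is a natural 1-commutative
diagram of functors … `C^un-tr → (C^un-tr)^pf → C^rlf` … the remaining functors are the functors that arise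
naturally from the construction of the 'unit-trivialization', 'perfection', and 'realification'".

`ModelFrobenioidMap.lean` (seat abc-iut-L1-t5) builds, in the model descriptions (model of `(Φ, Ψ)`, of
`(Φ^pf, Ψ^pf)`, of `(Φ^rlf, ℝ · Ψ)` for a realification datum `R : RealificationData Φ`), the functors
`Ψ.toPfModel : C^un-tr → (C^un-tr)^pf` and `R.toRlfModel : C^un-tr → C^rlf`.  This file supplies the missing
ROW functor and the 1-commutativity of the triangle, GENERICALLY in `R` (so in particular for THE data
`RealificationData.canonical`, file `RealificationDataCanonical.lean`):

* `RealificationData.rsmul_natCast` — in the `ℝ`-vector space `(Φ^rlf)^gp(X)` of `R`, `n • x = x^n`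
  (from the interface laws `rsmul_add`, `rsmul_one`); hence `R.pfToRlfGp` maps `Ψ^pf = ℚ · Ψ` into `ℝ · Ψ`:
  if `x^n = ι(c)` then `ι'(x) = (1/n) • ι(c)` (`gpApp_pfToRlf_mem_realSpan`);
* `RealificationData.pfToRlfData R Ψ` — the data morphism `(Φ^pf, Ψ^pf) → (Φ^rlf, ℝ · Ψ)` along
  `Φ^pf → Φ^rlf`, and **`R.pfToRlfModel Ψ : Ψ.PfModelOf ⥤ R.RlfModelOf Ψ`** = `(C^un-tr)^pf → C^rlf`;
* `ModelFrobenioid.isoOfClsEq` — the isomorphism `(A, α) ≅ (A, β)` of a model Frobenioid for `α = β`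
  (`(1, id, 0, 0)`), and **`RealificationData.rowTriangleIso`**:
  `Ψ.toPfModel ⋙ R.pfToRlfModel Ψ ≅ R.toRlfModel Ψ` (1-commutativity: on objects both send `(A, α)` to
  `(A, ι^gp(α))`, `ι = (Φ → Φ^pf → Φ^rlf)`; on morphisms they agree on the nose).

No statement of the paper is re-typed.  Seat abc-iut-L1-d2 (cell abc-iut), row
«FrdI:Def2.4(ii)-ℝ-action + I3-MERGE RealificationData» (L1-lead R45 (4)).
-/

noncomputable section

namespace Literature.AlgebraicGeometry.Frobenioids

open CategoryTheory Opposite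

universe w v u

variable {D : Type u} [Category.{v} D]

/-! ### An isomorphism `(A, α) ≅ (A, β)` in a model Frobenioid when `α = β` -/

namespace ModelFrobenioid

variable {Φ B : Dᵒᵖ ⥤ CommMonCat.{w}} {DivB : B ⟶ monoidGp Φ}

/-- The morphism `(1, id_A, 0, 0) : (A, α) → (A, β)` of the model Frobenioid when `α = β` (relation (d) of
Thm. 5.2 (i) reads `α = β`). [cite: MochizukiFrdI2008, Thm. 5.2 (i) p.100] -/
def homOfClsEq {A : D} {α β : Algebra.GrothendieckGroup (Φ.obj (op A))} (h : α = β) :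
    (⟨A, α⟩ : ModelFrobenioid Φ B DivB) ⟶ ⟨A, β⟩ where
  degFr := 1
  base := 𝟙 A
  div := 1
  unit := 1
  rel := by
    subst h
    rw [PNat.one_coe, pow_one, map_one, mul_one, map_one, mul_one, pullGp_id]

/-- `deg_Fr (1, id, 0, 0) = 1`. [cite: MochizukiFrdI2008, Thm. 5.2 (i) p.100] -/
@[simp] theorem degFr_homOfClsEq {A : D} {α β : Algebra.GrothendieckGroup (Φ.obj (op A))} (h : α = β) :
    degFr (homOfClsEq (B := B) (DivB := DivB) h) = 1 := rfl

/-- `Base (1, id, 0, 0) = id`. [cite: MochizukiFrdI2008, Thm. 5.2 (i) p.100] -/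
@[simp] theorem baseMap_homOfClsEq {A : D} {α β : Algebra.GrothendieckGroup (Φ.obj (op A))} (h : α = β) :
    baseMap (homOfClsEq (B := B) (DivB := DivB) h) = 𝟙 A := rfl

/-- `Div (1, id, 0, 0) = 0`. [cite: MochizukiFrdI2008, Thm. 5.2 (i) p.100] -/
@[simp] theorem div_homOfClsEq {A : D} {α β : Algebra.GrothendieckGroup (Φ.obj (op A))} (h : α = β) :
    div (homOfClsEq (B := B) (DivB := DivB) h) = 1 := rfl

/-- `u_{(1, id, 0, 0)} = 0`. [cite: MochizukiFrdI2008, Thm. 5.2 (i) p.100] -/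
@[simp] theorem unit_homOfClsEq {A : D} {α β : Algebra.GrothendieckGroup (Φ.obj (op A))} (h : α = β) :
    unit (homOfClsEq (B := B) (DivB := DivB) h) = 1 := rfl

/-- **`(A, α) ≅ (A, β)` when `α = β`**, by `(1, id, 0, 0)` both ways. [cite: MochizukiFrdI2008, Thm. 5.2 (i) p.100] -/
def isoOfClsEq {A : D} {α β : Algebra.GrothendieckGroup (Φ.obj (op A))} (h : α = β) :
    (⟨A, α⟩ : ModelFrobenioid Φ B DivB) ≅ ⟨A, β⟩ where
  hom := homOfClsEq h
  inv := homOfClsEq h.symm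
  hom_inv_id := by
    apply hom_ext
    · rfl
    · exact Category.id_comp _
    · rw [div_comp, div_homOfClsEq, div_homOfClsEq, map_one, one_pow, mul_one, div_id]
    · rw [unit_comp, unit_homOfClsEq, unit_homOfClsEq, map_one, one_pow, mul_one, unit_id]
  inv_hom_id := by
    apply hom_ext
    · rfl
    · exact Category.id_comp _
    · rw [div_comp, div_homOfClsEq, div_homOfClsEq, map_one, one_pow, mul_one, div_id]
    · rw [unit_comp, unit_homOfClsEq, unit_homOfClsEq, map_one, one_pow, mul_one, unit_id]

end ModelFrobenioid

/-! ### `n • x = x^n` in the `ℝ`-vector space of a realification datum; `Ψ^pf → ℝ · Ψ` -/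

namespace RealificationData

variable {Φ : Dᵒᵖ ⥤ CommMonCat.{w}} (R : RealificationData Φ)

/-- `0 • x = 1` in `(Φ^rlf)^gp(X)` (from `rsmul_add`). [cite: MochizukiFrdI2008, Def. 2.4(i) p.48] -/
theorem rsmul_zero (X : D) (x : Algebra.GrothendieckGroup (R.rlf.obj (op X))) : R.rsmul X 0 x = 1 := by
  have h := R.rsmul_add X 0 0 x
  rw [add_zero] at h
  exact left_eq_mul.mp h ▸ rfl

/-- `n • x = x^n` in `(Φ^rlf)^gp(X)` for `n ∈ ℕ` (from `rsmul_add`, `rsmul_one`).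
[cite: MochizukiFrdI2008, Def. 2.4(i) p.48] -/
theorem rsmul_natCast (X : D) (n : ℕ) (x : Algebra.GrothendieckGroup (R.rlf.obj (op X))) :
    R.rsmul X (n : ℝ) x = x ^ n := by
  induction n with
  | zero => rw [Nat.cast_zero, pow_zero, rsmul_zero]
  | succ n ih => rw [Nat.cast_succ, R.rsmul_add, ih, R.rsmul_one, pow_succ]

/-- `(1/n) • x^n = x` in `(Φ^rlf)^gp(X)` for `n ≥ 1`. [cite: MochizukiFrdI2008, Def. 2.4(i) p.48] -/
theorem rsmul_inv_natCast_pow (X : D) {n : ℕ} (hn : 0 < n) (x : Algebra.GrothendieckGroup (R.rlf.obj (op X))) :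
    R.rsmul X ((n : ℝ)⁻¹) (x ^ n) = x := by
  have hn' : (n : ℝ) ≠ 0 := Nat.cast_ne_zero.mpr hn.ne'
  rw [← R.rsmul_natCast X n x, ← R.rsmul_mul, inv_mul_cancel₀ hn', R.rsmul_one]

/-- `ι' := (Φ^pf → Φ^rlf)^gp` composed with `(Φ → Φ^pf)^gp` is `ι = (Φ → Φ^rlf)^gp`.
[cite: MochizukiFrdI2008, Prop. 5.3 p.103] -/
theorem gpApp_pfToRlf_toPfGp (X : D) (c : Algebra.GrothendieckGroup (Φ.obj (op X))) :
    gpApp R.pfToRlf (op X) (toPfGp Φ X c) = R.toRlfGp X c := by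
  change (MonGp.map (R.pfToRlf.app (op X)).hom).comp (MonGp.map ((toPerfectionFunctor Φ).app (op X)).hom) c =
    MonGp.map ((toPerfectionFunctor Φ ≫ R.pfToRlf).app (op X)).hom c
  rw [← MonGp.map_comp]
  rfl

variable (Ψ : GpSubfunctor Φ)

/-- **`(Φ^pf → Φ^rlf)^gp` maps `Ψ^pf = ℚ · Ψ` into `ℝ · Ψ`**: if `x^n = ι(c)` with `c ∈ Ψ(X)` then
`ι'(x) = (1/n) • ι(c)`, a generator of `ℝ · Ψ(X)`. [cite: MochizukiFrdI2008, Prop. 5.3 p.103] -/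
theorem gpApp_pfToRlf_mem_realSpan (X : D)
    (x : Algebra.GrothendieckGroup ((perfectionFunctor Φ).obj (op X))) (hx : x ∈ Ψ.perfection.carrier X) :
    gpApp R.pfToRlf (op X) x ∈ (R.realSpan Ψ).carrier X := by
  obtain ⟨n, c, hc, hcx⟩ := hx
  apply Subgroup.subset_closure
  refine ⟨((n : ℕ) : ℝ)⁻¹, c, hc, ?_⟩
  rw [← gpApp_pfToRlf_toPfGp, hcx, map_pow, rsmul_inv_natCast_pow R X n.pos]

/-- **The data morphism `(Φ^pf, Ψ^pf) → (Φ^rlf, ℝ · Ψ)`** along `Φ^pf → Φ^rlf` — for `Ψ = Φ^birat`: the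
data behind `(C^un-tr)^pf → C^rlf` ("induced by `Φ^pf → Φ^rlf`, `(Φ^birat)^pf → ℝ · Φ^birat`").
[cite: MochizukiFrdI2008, Prop. 5.3 p.103] -/
def pfToRlfData : ModelFrobenioid.DataHom Ψ.perfection.incl (R.realSpan Ψ).incl :=
  Ψ.perfection.dataHomOfLE (R.realSpan Ψ) R.pfToRlf fun X x hx => R.gpApp_pfToRlf_mem_realSpan Ψ X x hx

/-- **The functor `(C^un-tr)^pf → C^rlf`** in the model descriptions: "model of `(Φ^pf, Ψ^pf)` → model of
`(Φ^rlf, ℝ · Ψ)`", the last arrow of the bottom row of the diagram of Prop. 5.3.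
[cite: MochizukiFrdI2008, Prop. 5.3 p.103] -/
abbrev pfToRlfModel : Ψ.PfModelOf ⥤ R.RlfModelOf Ψ := (R.pfToRlfData Ψ).functor

/-- On base objects `(C^un-tr)^pf → C^rlf` is the identity. [cite: MochizukiFrdI2008, Prop. 5.3 p.103] -/
theorem pfToRlfModel_obj_base (Y : Ψ.PfModelOf) : ((R.pfToRlfModel Ψ).obj Y).base = Y.base := rfl

/-- On classes `(C^un-tr)^pf → C^rlf` is `(Φ^pf → Φ^rlf)^gp`. [cite: MochizukiFrdI2008, Prop. 5.3 p.103] -/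
theorem pfToRlfModel_obj_cls (Y : Ψ.PfModelOf) :
    ((R.pfToRlfModel Ψ).obj Y).cls = gpApp R.pfToRlf (op Y.base) Y.cls := rfl

/-! ### 1-commutativity of the triangle `C^un-tr → (C^un-tr)^pf → C^rlf` / `C^un-tr → C^rlf` -/

/-- The two composites agree on classes: `ι'^gp(ι_pf^gp(α)) = ι^gp(α)`. [cite: MochizukiFrdI2008, Prop. 5.3 p.103] -/
theorem row_obj_cls_eq (X : Ψ.ModelOf) :
    ((Ψ.toPfModel ⋙ R.pfToRlfModel Ψ).obj X).cls = ((R.toRlfModel Ψ).obj X).cls :=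
  R.gpApp_pfToRlf_toPfGp X.base X.cls

/-- **1-commutativity of the bottom row of the diagram of Prop. 5.3 (model description):**
`(C^un-tr → (C^un-tr)^pf → C^rlf) ≅ (C^un-tr → C^rlf)`, by the isomorphisms `(1, id, 0, 0)` — both functors
send `(A, α)` to `(A, ι^gp(α))` and act identically on the data of morphisms.
[cite: MochizukiFrdI2008, Prop. 5.3 p.103] -/
def rowTriangleIso : Ψ.toPfModel ⋙ R.pfToRlfModel Ψ ≅ R.toRlfModel Ψ :=
  NatIso.ofComponents (fun X => ModelFrobenioid.isoOfClsEq (R.row_obj_cls_eq Ψ X)) (fun {X Y} φ => by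
    apply ModelFrobenioid.hom_ext
    · change (1 : ℕ+) * ModelFrobenioid.degFr ((Ψ.toPfModel ⋙ R.pfToRlfModel Ψ).map φ) =
        ModelFrobenioid.degFr ((R.toRlfModel Ψ).map φ) * 1
      rw [one_mul, mul_one]
      rfl
    · change (ModelFrobenioid.baseMap φ ≫ 𝟙 _) = 𝟙 _ ≫ ModelFrobenioid.baseMap φ
      rw [Category.comp_id, Category.id_comp]
    · rw [ModelFrobenioid.div_comp, ModelFrobenioid.div_comp]
      change (R.rlf.map (ModelFrobenioid.baseMap φ).op).hom 1 *
          ((R.pfToRlf.app _).hom (((toPerfectionFunctor Φ).app _).hom (ModelFrobenioid.div φ))) ^ ((1 : ℕ+) : ℕ) =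
        (R.rlf.map (𝟙 _ : X.base ⟶ X.base).op).hom
          (((toPerfectionFunctor Φ ≫ R.pfToRlf).app _).hom (ModelFrobenioid.div φ)) * 1 ^ (ModelFrobenioid.degFr φ : ℕ)
      rw [map_one, one_mul, PNat.one_coe, pow_one, one_pow, mul_one, op_id, R.rlf.map_id]
      rfl
    · rw [ModelFrobenioid.unit_comp, ModelFrobenioid.unit_comp]
      change ((R.realSpan Ψ).toMonoid.map (ModelFrobenioid.baseMap φ).op).hom 1 *
          (((R.pfToRlfData Ψ).β.app _).hom (((Ψ.toPerfectionData).β.app _).hom (ModelFrobenioid.unit φ))) ^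
            ((1 : ℕ+) : ℕ) =
        ((R.realSpan Ψ).toMonoid.map (𝟙 _ : X.base ⟶ X.base).op).hom
          (((R.ofBaseData Ψ).β.app _).hom (ModelFrobenioid.unit φ)) * 1 ^ (ModelFrobenioid.degFr φ : ℕ)
      rw [map_one, one_mul, PNat.one_coe, pow_one, one_pow, mul_one, op_id, CategoryTheory.Functor.map_id]
      apply Subtype.ext
      exact R.gpApp_pfToRlf_toPfGp X.base _)

end RealificationData

end Literature.AlgebraicGeometry.Frobenioids
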